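import Literature.Analysis.PDE.LoewnerNirenbergKelvin
import Mathlib.Analysis.Calculus.Gradient.Basic
import Mathlib.Analysis.InnerProductSpace.PiL2
import HarnessLib

/-!
# HarmonicShellLaplacian — plates E0/E1/E2 of ROUND-41 «IsotropicBlobPressureLaw»
# (Fischer shells / Kelvin multipoles)

Generic potential theory on `EuclideanSpace ℝ (Fin 3)` keyed by the LEAD S-door (ns-s30-p1 g4, PLATE MAP
ROUND-41, 2026-08-28T22:09:23Z) for nsreg-p1 g33's ROUND-41 (the Fischer-shell Newton potential of an
isotropic blob): with `h` harmonic at `x ≠ 0` and satisfying the EULER IDENTITY `⟪x, ∇h(x)⟫ = l·h(x)` there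
(homogeneity of degree `l`, in the pointwise form the computation consumes),

* (E0) `laplacian_norm_rpow_mul`: `Δ(‖·‖^α h)(x) = α(α + 2l + 1)‖x‖^{α−2} h(x)` (real `α`, `x ≠ 0`);
* (E1) `laplacian_norm_pow_mul`: for `h ∈ C²` harmonic with the Euler identity everywhere and `j l : ℕ`,
  `Δ(‖·‖^{2j+2} h) = (2j+2)(2j+2l+3)‖·‖^{2j} h` at EVERY point (the origin by continuity of both sides:
  the Laplacian of a `C²` function is continuous and `{0}ᶜ` is dense) — the Fischer-shell identity;
* (E2) `laplacian_norm_rpow_neg_mul`: `Δ(‖·‖^{−(2l+1)} h)(x) = 0` for `x ≠ 0` — the Kelvin multipole is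
  harmonic off the origin (E0 at `α = −(2l+1)`).

Proof of E0: `‖y‖^α = (‖y‖²)^{α/2}`; the pointwise Leibniz rule for the Laplacian
(`Literature.Analysis.PDE.LoewnerNirenberg.laplacian_smul_apply`, both factors `C²` AT the point), the
radial calculus `Literature.Analysis.FluidPDE.laplacian_comp_norm_sq` / `fderiv_comp_norm_sq_apply`
(`Δ‖y‖^α = α(α+1)‖y‖^{α−2}`, `∇‖y‖^α = α‖y‖^{α−2} y` in `ℝ³`) and the Euler identity for the cross term
`2⟪∇‖y‖^α, ∇h⟫ = 2αl‖x‖^{α−2}h`. Everything proved; no definitions, no named facts;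
`--supports stmt-NavierStokesRegularity-0056 --as helper` (typed by ns-s29-p2 g5).
[folklore: Stein–Weiss, *Fourier Analysis on Euclidean Spaces*, Ch. IV §2; Axler–Bourdon–Ramey,
*Harmonic Function Theory*, Ch. 4–5 (Kelvin transform, homogeneous harmonic polynomials).]

HONEST FRAME: plates for a kinematic slice law that calibrates the S40/S41 clock doors; items 0056
`NoTypeII`, 10661 and NS regularity are NOT proved; nothing here is a route or a summit statement.
-/

noncomputable section

open Set Filter InnerProductSpace
open scoped Laplacian RealInnerProductSpace Topology ContDiff

set_option linter.dupNamespace false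

namespace Summit.NavierStokesRegularity.NavierStokesRegularity.Theorems.StrainDoors.HarmonicShell

/-- `Σ_i ⟨x, e_i⟩ · Dh(x) e_i = Dh(x) x` along an orthonormal basis. [folklore] -/
theorem sum_inner_mul_fderiv_eq {ι : Type*} [Fintype ι] (b : OrthonormalBasis ι ℝ (EuclideanSpace ℝ (Fin 3)))
    (h : EuclideanSpace ℝ (Fin 3) → ℝ) (x : EuclideanSpace ℝ (Fin 3)) :
    ∑ i, ⟪x, b i⟫ * fderiv ℝ h x (b i) = fderiv ℝ h x x := by
  calc ∑ i, ⟪x, b i⟫ * fderiv ℝ h x (b i) = fderiv ℝ h x (∑ i, ⟪x, b i⟫ • b i) := by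
        rw [map_sum]
        exact Finset.sum_congr rfl fun i _ => by rw [map_smul, smul_eq_mul]
    _ = fderiv ℝ h x x := by rw [Literature.Analysis.PDE.LoewnerNirenberg.sum_inner_smul_eq]

/-- `(‖x‖²)^β = ‖x‖^{2β}` (real exponent). [folklore] -/
theorem norm_sq_rpow (x : EuclideanSpace ℝ (Fin 3)) (β : ℝ) : (‖x‖ ^ 2) ^ β = ‖x‖ ^ (2 * β) := by
  rw [← Real.rpow_two, ← Real.rpow_mul (norm_nonneg x)]

/-- **(E0) Laplacian of `‖·‖^α h` for `h` harmonic and Euler-homogeneous of degree `l` at `x ≠ 0`**: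
`Δ(‖·‖^α h)(x) = α(α + 2l + 1)‖x‖^{α−2} h(x)` (in `ℝ³`: `Δ‖y‖^α = α(α+1)‖y‖^{α−2}`,
`2⟪∇‖y‖^α, ∇h⟫ = 2αl‖y‖^{α−2}h`). The hypotheses on `h` are pointwise at `x`. [folklore] -/
theorem laplacian_norm_rpow_mul (α l : ℝ) {h : EuclideanSpace ℝ (Fin 3) → ℝ} {x : EuclideanSpace ℝ (Fin 3)}
    (hx : x ≠ 0) (hh : ContDiffAt ℝ 2 h x) (hΔ : Δ h x = 0) (hE : ⟪x, gradient h x⟫ = l * h x) :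
    Δ (fun y => ‖y‖ ^ α * h y) x = α * (α + 2 * l + 1) * ‖x‖ ^ (α - 2) * h x := by
  set b := stdOrthonormalBasis ℝ (EuclideanSpace ℝ (Fin 3))
  have hxn : 0 < ‖x‖ := norm_pos_iff.2 hx
  have hs : 0 < ‖x‖ ^ 2 := by positivity
  -- `‖y‖^α h(y) = (‖y‖²)^{α/2} • h(y)`
  have hfun : (fun y => ‖y‖ ^ α * h y) = fun y => (‖y‖ ^ 2) ^ (α / 2) • h y := by
    funext y
    rw [smul_eq_mul, norm_sq_rpow, show 2 * (α / 2) = α by ring]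
  -- derivative data of the radial coefficient `c(σ) = σ^{α/2}` on `σ > 0`
  have hgd : ∀ σ ∈ Ioi (0 : ℝ),
      HasDerivAt (fun τ : ℝ => τ ^ (α / 2)) (α / 2 * σ ^ (α / 2 - 1)) σ := fun σ hσ =>
    Literature.Analysis.PDE.LoewnerNirenberg.hasDerivAt_rpow_const_of_pos (α / 2) (α / 2 - 1) rfl hσ
  have hg₁d : HasDerivAt (fun σ : ℝ => α / 2 * σ ^ (α / 2 - 1))
      (α / 2 * ((α / 2 - 1) * (‖x‖ ^ 2) ^ (α / 2 - 2))) (‖x‖ ^ 2) :=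
    (Literature.Analysis.PDE.LoewnerNirenberg.hasDerivAt_rpow_const_of_pos (α / 2 - 1) (α / 2 - 2)
      (by ring) hs).const_mul (α / 2)
  have hc2 : ContDiffAt ℝ 2 (fun y : EuclideanSpace ℝ (Fin 3) => (‖y‖ ^ 2) ^ (α / 2)) x :=
    (contDiff_norm_sq ℝ).contDiffAt.rpow_const_of_ne hs.ne'
  rw [hfun, Literature.Analysis.PDE.LoewnerNirenberg.laplacian_smul_apply hc2 hh b, hΔ, smul_zero,
    add_zero, Literature.Analysis.FluidPDE.laplacian_comp_norm_sq (E := EuclideanSpace ℝ (Fin 3))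
      isOpen_Ioi hgd hs hg₁d]
  have hD : ∀ i, fderiv ℝ (fun y : EuclideanSpace ℝ (Fin 3) => (‖y‖ ^ 2) ^ (α / 2)) x (b i) =
      2 * (α / 2 * (‖x‖ ^ 2) ^ (α / 2 - 1)) * ⟪x, b i⟫ := fun i =>
    Literature.Analysis.FluidPDE.fderiv_comp_norm_sq_apply (hgd _ hs) (b i)
  simp only [hD, smul_eq_mul]
  -- the cross term via the Euler identity
  have hEul : fderiv ℝ h x x = l * h x := by
    rw [← hE, real_inner_comm, gradient, toDual_symm_apply]
    -- (`⟪x, ∇h(x)⟫ = Dh(x)·x`; cf. `Literature.Analysis.FluidPDE.EulerReynoldsLadder.inner_gradient_eq_fderiv`)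
  have hsum : ∑ i, 2 * (α / 2 * (‖x‖ ^ 2) ^ (α / 2 - 1)) * ⟪x, b i⟫ * fderiv ℝ h x (b i) =
      2 * (α / 2 * (‖x‖ ^ 2) ^ (α / 2 - 1)) * (l * h x) := by
    rw [← hEul, ← sum_inner_mul_fderiv_eq b h x, Finset.mul_sum]
    exact Finset.sum_congr rfl fun i _ => by ring
  rw [hsum, finrank_euclideanSpace_fin]
  -- radial powers: `(‖x‖²)^{α/2−1} = ‖x‖^{α−2}`, `(‖x‖²)^{α/2−2}·‖x‖² = ‖x‖^{α−2}`
  have h1 : (‖x‖ ^ 2) ^ (α / 2 - 1) = ‖x‖ ^ (α - 2) := by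
    rw [norm_sq_rpow, show 2 * (α / 2 - 1) = α - 2 by ring]
  have h2 : (‖x‖ ^ 2) ^ (α / 2 - 2) * ‖x‖ ^ 2 = ‖x‖ ^ (α - 2) := by
    rw [norm_sq_rpow, show 2 * (α / 2 - 2) = (α - 2) + (-2) by ring, Real.rpow_add hxn,
      show (-2 : ℝ) = -((2 : ℕ) : ℝ) by norm_num, Real.rpow_neg hxn.le, Real.rpow_natCast,
      mul_assoc, inv_mul_cancel₀ hs.ne', mul_one]
  have h2' : 4 * (α / 2 * ((α / 2 - 1) * (‖x‖ ^ 2) ^ (α / 2 - 2))) * ‖x‖ ^ 2 =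
      α * (α - 2) * ((‖x‖ ^ 2) ^ (α / 2 - 2) * ‖x‖ ^ 2) := by ring
  rw [h2', h2, h1]
  push_cast
  ring

/-- **(E2) Kelvin multipoles are harmonic off the origin**: for `h` harmonic and Euler-homogeneous of degree
`l` at `x ≠ 0`, `Δ(‖·‖^{−(2l+1)} h)(x) = 0` (E0 at `α = −(2l+1)`, where `α + 2l + 1 = 0`). [folklore] -/
theorem laplacian_norm_rpow_neg_mul (l : ℕ) {h : EuclideanSpace ℝ (Fin 3) → ℝ} {x : EuclideanSpace ℝ (Fin 3)}
    (hx : x ≠ 0) (hh : ContDiffAt ℝ 2 h x) (hΔ : Δ h x = 0) (hE : ⟪x, gradient h x⟫ = l * h x) :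
    Δ (fun y => ‖y‖ ^ (-(2 * (l : ℝ) + 1)) * h y) x = 0 := by
  rw [laplacian_norm_rpow_mul (-(2 * (l : ℝ) + 1)) l hx hh hΔ hE]
  ring

/-- The Laplacian of a `C²` function is continuous. [folklore] -/
theorem continuous_laplacian_of_contDiff {F : EuclideanSpace ℝ (Fin 3) → ℝ} (hF : ContDiff ℝ 2 F) :
    Continuous (Δ F) := by
  rw [laplacian_eq_iteratedFDeriv_orthonormalBasis F (stdOrthonormalBasis ℝ (EuclideanSpace ℝ (Fin 3)))]
  refine continuous_finsetSum _ fun i _ => ?_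
  exact (continuous_eval_const _).comp (hF.continuous_iteratedFDeriv le_rfl)

/-- **(E1) The Fischer-shell identity**: for `h ∈ C²(ℝ³)` harmonic with the Euler identity
`⟪x, ∇h(x)⟫ = l·h(x)` everywhere (`l : ℕ`; e.g. a harmonic homogeneous polynomial of degree `l`) and `j : ℕ`,
`Δ(‖·‖^{2j+2} h)(x) = (2j+2)(2j+2l+3)‖x‖^{2j} h(x)` at EVERY `x` — at the origin by continuity of both sides
(`{0}ᶜ` is dense). [folklore] -/
theorem laplacian_norm_pow_mul (j l : ℕ) {h : EuclideanSpace ℝ (Fin 3) → ℝ} (hh : ContDiff ℝ 2 h)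
    (hΔ : ∀ x, Δ h x = 0) (hE : ∀ x : EuclideanSpace ℝ (Fin 3), ⟪x, gradient h x⟫ = l * h x)
    (x : EuclideanSpace ℝ (Fin 3)) :
    Δ (fun y => ‖y‖ ^ (2 * j + 2) * h y) x = (2 * j + 2) * (2 * j + 2 * l + 3) * ‖x‖ ^ (2 * j) * h x := by
  -- both sides are continuous
  have hF : ContDiff ℝ 2 (fun y => ‖y‖ ^ (2 * j + 2) * h y) := by
    have hsq : ContDiff ℝ 2 (fun y : EuclideanSpace ℝ (Fin 3) => (‖y‖ ^ 2) ^ (j + 1)) :=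
      (contDiff_norm_sq ℝ).pow (j + 1)
    have heq : (fun y => ‖y‖ ^ (2 * j + 2) * h y) = fun y => (‖y‖ ^ 2) ^ (j + 1) * h y := by
      funext y
      rw [← pow_mul, show 2 * (j + 1) = 2 * j + 2 by ring]
    rw [heq]
    exact hsq.mul hh
  have hc1 : Continuous (Δ (fun y => ‖y‖ ^ (2 * j + 2) * h y)) := continuous_laplacian_of_contDiff hF
  have hc2 : Continuous
      (fun x : EuclideanSpace ℝ (Fin 3) => (2 * j + 2 : ℝ) * (2 * j + 2 * l + 3) * ‖x‖ ^ (2 * j) * h x) :=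
    ((continuous_const.mul continuous_const).mul (continuous_norm.pow _)).mul hh.continuous
  refine congrFun (Continuous.ext_on (dense_compl_singleton (0 : EuclideanSpace ℝ (Fin 3))) hc1 hc2
    fun y hy => ?_) x
  -- off the origin: E0 with `α = 2j+2`
  have hy : y ≠ 0 := hy
  have hreal : (fun z => ‖z‖ ^ (2 * j + 2) * h z) = fun z => ‖z‖ ^ ((2 * j + 2 : ℕ) : ℝ) * h z := by
    funext z
    rw [Real.rpow_natCast]
  have h0 := laplacian_norm_rpow_mul ((2 * j + 2 : ℕ) : ℝ) l hy hh.contDiffAt (hΔ y) (hE y)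
  rw [hreal, h0, show ((2 * j + 2 : ℕ) : ℝ) - 2 = ((2 * j : ℕ) : ℝ) by push_cast; ring, Real.rpow_natCast]
  push_cast
  ring

end Summit.NavierStokesRegularity.NavierStokesRegularity.Theorems.StrainDoors.HarmonicShell

end
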